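import Literature.Topology.PlaneTopology.CrosscutProofs
import Literature.Probability.RandomPlanarGeometry.PlanarDomains
import HarnessLib

/-!
# Radó squeezes, part 2: free arcs of a Jordan sub-domain

Support file (`--supports stmt-CriticalPhenomena-0773`, towards the registered stub `stub_radoSqueezeFamily`,
geometry F′ of the line `birth` for the crux `RestrictionOfLimit`). Pure plane topology / real analysis.

For Dobrushin domains `D' ⊆ D` with common marked points `a = D'.boundary m₀`, `b`, the FREE SET
`F = {θ | D'.boundary θ ∈ D}` of parameters of `∂D'` lying inside `D` is open and `1`-periodic and misses
`m₀ + ℤ`, `m₁ + ℤ`. The connected component of `x ∈ F ∩ (m₀, m₀ + 1)` is an open interval `(θ₁, θ₂)` with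
`m₀ ≤ θ₁ < x < θ₂ ≤ m₀ + 1`, `θ₂ - θ₁ < 1`, `θ₁, θ₂ ∉ F`; its image, the FREE ARC, is an open arc of `∂D'`
inside `D`, and its closure `D'.boundary '' [θ₁, θ₂]` is a cross-cut of `D` between the distinct boundary
points `P = D'.boundary θ₁`, `Q = D'.boundary θ₂` of `D`. Closed free arcs of distinct components meet at
most in the end-points of either, and the complementary closed arc `D'.boundary '' [θ₂, θ₁ + 1]` of `∂D'`
misses the open free arc.

References: Ch. Pommerenke, *Boundary Behaviour of Conformal Maps* (1992), §2. Axioms `propext`,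
`Classical.choice`, `Quot.sound`.
-/

noncomputable section

open Set Filter Topology Metric
open Literature.Topology.PlaneTopology Literature.Probability.RandomPlanarGeometry

namespace Summit.CriticalPhenomena.SAWScalingLimit.Theorems.RestrictionOfLimit.Birth

/-! ### Components of open subsets of the line -/

/-- **Components of an open subset of `ℝ` between two non-members are open intervals.** If `F ⊆ ℝ` is open,
`x ∈ F` and `l < x < r` with `l, r ∉ F`, then the connected component `C` of `x` in `F` is the open interval
`(inf C, sup C)`, with `l ≤ inf C < x < sup C ≤ r` and `inf C, sup C ∉ F`. [folklore] -/
theorem component_eq_Ioo {F : Set ℝ} (hF : IsOpen F) {x l r : ℝ} (hx : x ∈ F) (hl : l ∉ F) (hr : r ∉ F)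
    (hlx : l < x) (hxr : x < r) :
    connectedComponentIn F x = Ioo (sInf (connectedComponentIn F x)) (sSup (connectedComponentIn F x)) ∧
      sInf (connectedComponentIn F x) ∉ F ∧ sSup (connectedComponentIn F x) ∉ F ∧
      l ≤ sInf (connectedComponentIn F x) ∧ sSup (connectedComponentIn F x) ≤ r ∧
      sInf (connectedComponentIn F x) < x ∧ x < sSup (connectedComponentIn F x) := by
  set C := connectedComponentIn F x with hC
  have hCF : C ⊆ F := connectedComponentIn_subset F x
  have hCc : IsPreconnected C := isPreconnected_connectedComponentIn
  have hxC : x ∈ C := mem_connectedComponentIn hx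
  have hCo : IsOpen C := hF.connectedComponentIn
  -- `C ⊆ (l, r)`
  have hCl : ∀ c ∈ C, l < c := fun c hc ↦ by
    by_contra h
    exact hl (hCF (hCc.Icc_subset hc hxC ⟨not_lt.1 h, hlx.le⟩))
  have hCr : ∀ c ∈ C, c < r := fun c hc ↦ by
    by_contra h
    exact hr (hCF (hCc.Icc_subset hxC hc ⟨hxr.le, not_lt.1 h⟩))
  have hbb : BddBelow C := ⟨l, fun c hc ↦ (hCl c hc).le⟩
  have hba : BddAbove C := ⟨r, fun c hc ↦ (hCr c hc).le⟩
  have hne : C.Nonempty := ⟨x, hxC⟩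
  -- open: members are strictly between inf and sup
  have hstrict : ∀ c ∈ C, sInf C < c ∧ c < sSup C := fun c hc ↦ by
    obtain ⟨ε, hε, hball⟩ := Metric.isOpen_iff.1 hCo c hc
    have h1 : c - ε / 2 ∈ C := hball (by rw [Real.ball_eq_Ioo]; constructor <;> linarith)
    have h2 : c + ε / 2 ∈ C := hball (by rw [Real.ball_eq_Ioo]; constructor <;> linarith)
    exact ⟨lt_of_le_of_lt (csInf_le hbb h1) (by linarith), lt_of_lt_of_le (by linarith) (le_csSup hba h2)⟩
  have hmemC : ∀ y, sInf C < y → y < sSup C → y ∈ C := fun y hy1 hy2 ↦ by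
    obtain ⟨c₁, hc₁, hc₁y⟩ := exists_lt_of_csInf_lt hne hy1
    obtain ⟨c₂, hc₂, hyc₂⟩ := exists_lt_of_lt_csSup hne hy2
    exact hCc.Icc_subset hc₁ hc₂ ⟨hc₁y.le, hyc₂.le⟩
  have heq : C = Ioo (sInf C) (sSup C) :=
    Subset.antisymm (fun c hc ↦ hstrict c hc) fun y hy ↦ hmemC y hy.1 hy.2
  -- the end-points are not in `F`
  have hends : sInf C ∉ F ∧ sSup C ∉ F := by
    constructor
    · intro hmem
      obtain ⟨ε, hε, hball⟩ := Metric.isOpen_iff.1 hF _ hmem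
      rw [Real.ball_eq_Ioo] at hball
      set δ : ℝ := min ε (x - sInf C) with hδ
      have hδ0 : 0 < δ := lt_min hε (by linarith [(hstrict x hxC).1])
      have hmid : sInf C + δ / 2 ∈ C :=
        hmemC _ (by linarith) (by linarith [min_le_right ε (x - sInf C), (hstrict x hxC).2])
      have hU : IsPreconnected (Ioo (sInf C - ε) (sInf C + ε) ∪ C) :=
        IsPreconnected.union (sInf C + δ / 2) ⟨by linarith, by linarith [min_le_left ε (x - sInf C)]⟩ hmid
          isPreconnected_Ioo hCc
      have hsub : Ioo (sInf C - ε) (sInf C + ε) ∪ C ⊆ C :=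
        hU.subset_connectedComponentIn (Or.inr hxC) (union_subset hball hCF)
      have hbad : sInf C - ε / 2 ∈ C := hsub (Or.inl ⟨by linarith, by linarith⟩)
      linarith [(hstrict _ hbad).1]
    · intro hmem
      obtain ⟨ε, hε, hball⟩ := Metric.isOpen_iff.1 hF _ hmem
      rw [Real.ball_eq_Ioo] at hball
      set δ : ℝ := min ε (sSup C - x) with hδ
      have hδ0 : 0 < δ := lt_min hε (by linarith [(hstrict x hxC).2])
      have hmid : sSup C - δ / 2 ∈ C :=
        hmemC _ (by linarith [min_le_right ε (sSup C - x), (hstrict x hxC).1]) (by linarith)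
      have hU : IsPreconnected (Ioo (sSup C - ε) (sSup C + ε) ∪ C) :=
        IsPreconnected.union (sSup C - δ / 2) ⟨by linarith [min_le_left ε (sSup C - x)], by linarith⟩ hmid
          isPreconnected_Ioo hCc
      have hsub : Ioo (sSup C - ε) (sSup C + ε) ∪ C ⊆ C :=
        hU.subset_connectedComponentIn (Or.inr hxC) (union_subset hball hCF)
      have hbad : sSup C + ε / 2 ∈ C := hsub (Or.inl ⟨by linarith, by linarith⟩)
      linarith [(hstrict _ hbad).2]
  refine ⟨heq, hends.1, hends.2, ?_, ?_, (hstrict x hxC).1, (hstrict x hxC).2⟩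
  · exact le_csInf hne fun c hc ↦ (hCl c hc).le
  · exact csSup_le hne fun c hc ↦ (hCr c hc).le

/-! ### The free set of a Jordan sub-domain -/

section Free

variable {D D' : DobrushinDomain} {F : Set ℝ} (hF : F = {θ : ℝ | D'.boundary θ ∈ D.carrier})

include hF

/-- The free set is open. [folklore] -/
theorem isOpen_free : IsOpen F := by
  rw [hF]
  exact D.isOpen.preimage D'.continuous_boundary

/-- The free set is `1`-periodic. [folklore] -/
theorem mem_free_add_int_iff (θ : ℝ) (k : ℤ) : θ + k ∈ F ↔ θ ∈ F := by
  rw [hF, mem_setOf_eq, mem_setOf_eq, show θ + (k : ℝ) = θ + k * 1 by ring, D'.periodic_boundary.int_mul k]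

/-- Membership in the free set. [folklore] -/
theorem mem_free_iff (θ : ℝ) : θ ∈ F ↔ D'.boundary θ ∈ D.carrier := by
  rw [hF]; rfl

/-- Parameters of the marked points (plus integers) are not free, when the marked points are shared.
[folklore] -/
theorem mark_add_int_notMem_free (h0 : D'.pt 0 = D.pt 0) (h1 : D'.pt 1 = D.pt 1) (i : Fin 2) (k : ℤ) :
    D'.mark i + k ∉ F := by
  rw [mem_free_add_int_iff hF, mem_free_iff hF]
  intro h
  have hfr : D'.pt i ∈ frontier D.carrier := by
    fin_cases i
    · rw [show D'.pt ((fun i => i) ⟨0, by norm_num⟩) = D.pt 0 from h0]; exact D.pt_mem_frontier 0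
    · rw [show D'.pt ((fun i => i) ⟨1, by norm_num⟩) = D.pt 1 from h1]; exact D.pt_mem_frontier 1
  have := hfr.2
  rw [D.isOpen.interior_eq] at this
  exact this h

/-- **Normalising a free parameter into the window.** Every free parameter is congruent modulo `1` to a
free parameter of `(m₀, m₀ + 1)` with the same boundary point. [folklore] -/
theorem free_normalise (h0 : D'.pt 0 = D.pt 0) (h1 : D'.pt 1 = D.pt 1) {θ : ℝ} (hθ : θ ∈ F) :
    ∃ x ∈ F, x ∈ Ioo (D'.mark 0) (D'.mark 0 + 1) ∧ D'.boundary x = D'.boundary θ := by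
  set x : ℝ := D'.mark 0 + Int.fract (θ - D'.mark 0) with hx
  have hxθ : ∃ k : ℤ, x = θ + k := by
    refine ⟨-⌊θ - D'.mark 0⌋, ?_⟩
    rw [hx, Int.fract]
    push_cast
    ring
  obtain ⟨k, hk⟩ := hxθ
  have hxF : x ∈ F := by rw [hk]; exact (mem_free_add_int_iff hF θ k).2 hθ
  have hwx : D'.boundary x = D'.boundary θ := by
    rw [hk, show θ + (k : ℝ) = θ + k * 1 by ring]
    exact D'.periodic_boundary.int_mul k θ
  have hx0 : D'.mark 0 ≤ x := by rw [hx]; linarith [Int.fract_nonneg (θ - D'.mark 0)]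
  have hx1 : x < D'.mark 0 + 1 := by rw [hx]; linarith [Int.fract_lt_one (θ - D'.mark 0)]
  have hne : x ≠ D'.mark 0 := by
    rintro h
    have := mark_add_int_notMem_free hF h0 h1 0 0
    simp only [Int.cast_zero, add_zero] at this
    exact this (h ▸ hxF)
  exact ⟨x, hxF, ⟨lt_of_le_of_ne hx0 (Ne.symm hne), hx1⟩, hwx⟩

variable (hsub : D'.carrier ⊆ D.carrier) (h0 : D'.pt 0 = D.pt 0) (h1 : D'.pt 1 = D.pt 1) {x : ℝ}
  (hx : x ∈ F) (hxw : x ∈ Ioo (D'.mark 0) (D'.mark 0 + 1))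

include h0 h1 hx hxw

/-- **The component of a free parameter in the window `(m₀, m₀ + 1)`** is an open interval `(θ₁, θ₂)` with
`m₀ ≤ θ₁ < x < θ₂ ≤ m₀ + 1`, `θ₁, θ₂ ∉ F` and `θ₂ - θ₁ < 1`. [folklore] -/
theorem free_component :
    connectedComponentIn F x = Ioo (sInf (connectedComponentIn F x)) (sSup (connectedComponentIn F x)) ∧
      sInf (connectedComponentIn F x) ∉ F ∧ sSup (connectedComponentIn F x) ∉ F ∧
      D'.mark 0 ≤ sInf (connectedComponentIn F x) ∧ sSup (connectedComponentIn F x) ≤ D'.mark 0 + 1 ∧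
      sInf (connectedComponentIn F x) < x ∧ x < sSup (connectedComponentIn F x) ∧
      sSup (connectedComponentIn F x) - sInf (connectedComponentIn F x) < 1 := by
  have hl : D'.mark 0 ∉ F := by simpa using mark_add_int_notMem_free hF h0 h1 0 0
  have hr : D'.mark 0 + 1 ∉ F := by simpa using mark_add_int_notMem_free hF h0 h1 0 1
  obtain ⟨heq, hi, hs, hli, hsr, hix, hxs⟩ := component_eq_Ioo (isOpen_free hF) hx hl hr hxw.1 hxw.2
  refine ⟨heq, hi, hs, hli, hsr, hix, hxs, ?_⟩
  -- the parameter of `b` separates the window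
  have hm1 : D'.mark 1 ∉ F := by simpa using mark_add_int_notMem_free hF h0 h1 1 0
  have hm01 : D'.mark 0 < D'.mark 1 := D'.strictMono_mark (by decide)
  have hm1' : D'.mark 1 < D'.mark 0 + 1 := by linarith [(D'.mark_mem 1).2, (D'.mark_mem 0).1]
  by_contra hge
  rw [not_lt] at hge
  have hmem : D'.mark 1 ∈ connectedComponentIn F x := by
    rw [heq]
    exact ⟨by linarith, by linarith⟩
  exact hm1 (connectedComponentIn_subset F x hmem)

/-- The open free arc lies in `D` and on `∂D'`. [folklore] -/
theorem free_image_Ioo_subset :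
    D'.boundary '' Ioo (sInf (connectedComponentIn F x)) (sSup (connectedComponentIn F x)) ⊆
      D.carrier ∩ frontier D'.carrier := by
  obtain ⟨heq, -⟩ := free_component hF h0 h1 hx hxw
  rintro _ ⟨θ, hθ, rfl⟩
  refine ⟨?_, D'.boundary_mem_frontier θ⟩
  have : θ ∈ F := connectedComponentIn_subset F x (heq ▸ hθ)
  exact (mem_free_iff hF θ).1 this

/-- **The complementary closed arc of `∂D'` misses the open free arc**: for `θ ∈ (θ₁, θ₂)`, the point
`D'.boundary θ` is not on `D'.boundary '' [θ₂, θ₁ + 1]`. [folklore] -/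
theorem free_notMem_compl_arc {θ : ℝ}
    (hθ : θ ∈ Ioo (sInf (connectedComponentIn F x)) (sSup (connectedComponentIn F x))) :
    D'.boundary θ ∉ D'.boundary '' Icc (sSup (connectedComponentIn F x)) (sInf (connectedComponentIn F x) + 1) := by
  obtain ⟨-, -, -, -, -, hix, hxs, hlen⟩ := free_component hF h0 h1 hx hxw
  rintro ⟨θ', hθ', h⟩
  set θ₁ := sInf (connectedComponentIn F x)
  rcases hθ'.2.lt_or_eq with hlt | heq'
  · have := D'.injOn_boundary_Ico θ₁ ⟨hθ.1.le, by linarith [hθ.2]⟩ ⟨by linarith [hθ'.1], hlt⟩ h.symm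
    linarith [hθ'.1, hθ.2]
  · have h1' : D'.boundary θ = D'.boundary θ₁ := by
      rw [← h, heq']; exact D'.periodic_boundary θ₁
    have := D'.injOn_boundary_Ico θ₁ ⟨hθ.1.le, by linarith [hθ.2]⟩ ⟨le_rfl, by linarith⟩ h1'
    linarith [hθ.1]

/-- **The frontier of `D'` off the complementary closed arc is the open free arc.** [folklore] -/
theorem frontier_diff_compl_arc_subset :
    frontier D'.carrier \ D'.boundary '' Icc (sSup (connectedComponentIn F x)) (sInf (connectedComponentIn F x) + 1) ⊆
      D'.boundary '' Ioo (sInf (connectedComponentIn F x)) (sSup (connectedComponentIn F x)) := by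
  obtain ⟨-, -, -, -, -, hix, hxs, hlen⟩ := free_component hF h0 h1 hx hxw
  set θ₁ := sInf (connectedComponentIn F x)
  set θ₂ := sSup (connectedComponentIn F x)
  rintro z ⟨hz, hzn⟩
  rw [← D'.range_boundary] at hz
  obtain ⟨v, rfl⟩ := hz
  obtain ⟨v', hv', hvv'⟩ := D'.periodic_boundary.exists_mem_Ico one_pos v θ₁
  rw [hvv'] at hzn ⊢
  rcases lt_or_ge v' θ₂ with hlt | hge
  · rcases hv'.1.lt_or_eq with hlt' | heq'
    · exact ⟨v', ⟨hlt', hlt⟩, rfl⟩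
    · exfalso
      refine hzn ⟨θ₁ + 1, ⟨by linarith, le_rfl⟩, ?_⟩
      rw [← heq']
      exact D'.periodic_boundary θ₁
  · exact absurd ⟨v', ⟨hge, hv'.2.le⟩, rfl⟩ hzn

omit hx hxw in
/-- **Closed free arcs of distinct components meet at most in end-points.** For free parameters `x, y` of the
window with different components, a common point of the closed free arcs is `P x` or `Q x`. [folklore] -/
theorem free_arcs_inter {x y : ℝ} (hx : x ∈ F) (hxw : x ∈ Ioo (D'.mark 0) (D'.mark 0 + 1)) (hy : y ∈ F)
    (hyw : y ∈ Ioo (D'.mark 0) (D'.mark 0 + 1)) (hne : connectedComponentIn F x ≠ connectedComponentIn F y) :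
    D'.boundary '' Icc (sInf (connectedComponentIn F x)) (sSup (connectedComponentIn F x)) ∩
        D'.boundary '' Icc (sInf (connectedComponentIn F y)) (sSup (connectedComponentIn F y)) ⊆
      {D'.boundary (sInf (connectedComponentIn F x)), D'.boundary (sSup (connectedComponentIn F x))} := by
  obtain ⟨heqx, hix', hsx', hlx, hxr, hix, hxs, -⟩ := free_component hF h0 h1 hx hxw
  obtain ⟨heqy, hiy', hsy', hly, hyr, hiy, hys, -⟩ := free_component hF h0 h1 hy hyw
  have hm0 : D'.mark 0 ∉ F := by simpa using mark_add_int_notMem_free hF h0 h1 0 0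
  rintro z ⟨⟨θ, hθ, rfl⟩, ⟨θ', hθ', hzz⟩⟩
  -- the end-point cases
  rcases hθ.1.lt_or_eq with h1θ | h1θ
  swap; · exact Or.inl (by rw [h1θ])
  rcases hθ.2.lt_or_eq with h2θ | h2θ
  swap; · exact Or.inr (by rw [h2θ]; rfl)
  exfalso
  have hθC : θ ∈ connectedComponentIn F x := by rw [heqx]; exact ⟨h1θ, h2θ⟩
  have hθF : θ ∈ F := connectedComponentIn_subset F x hθC
  have hθw : θ ∈ Ico (D'.mark 0) (D'.mark 0 + 1) := ⟨hlx.trans h1θ.le, lt_of_lt_of_le h2θ hxr⟩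
  rcases hθ'.2.lt_or_eq with hlt | heq
  · -- `θ'` in the half-open window too
    have hθ'w : θ' ∈ Ico (D'.mark 0) (D'.mark 0 + 1) := ⟨hly.trans hθ'.1, lt_of_lt_of_le hlt hyr⟩
    have hθθ' : θ = θ' := D'.injOn_boundary_Ico (D'.mark 0) hθw hθ'w hzz.symm
    subst hθθ'
    rcases hθ'.1.lt_or_eq with h1 | h1
    · have hθCy : θ ∈ connectedComponentIn F y := by rw [heqy]; exact ⟨h1, hlt⟩
      exact hne ((connectedComponentIn_eq hθC).trans (connectedComponentIn_eq hθCy).symm)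
    · exact hiy' (h1 ▸ hθF)
  · -- `θ' = θ₂ y`; if moreover `θ₂ y = m₀ + 1` the common point is `a`
    rcases hyr.lt_or_eq with hlt2 | heq2
    · have hθ'w : θ' ∈ Ico (D'.mark 0) (D'.mark 0 + 1) := ⟨hly.trans hθ'.1, heq ▸ hlt2⟩
      have hθθ' : θ = θ' := D'.injOn_boundary_Ico (D'.mark 0) hθw hθ'w hzz.symm
      exact hsy' (heq ▸ hθθ' ▸ hθF)
    · have hza : D'.boundary θ = D'.boundary (D'.mark 0) := by
        rw [← hzz, heq, heq2]; exact D'.periodic_boundary _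
      have := D'.injOn_boundary_Ico (D'.mark 0) hθw ⟨le_rfl, by linarith⟩ hza
      exact hm0 (this ▸ hθF)

include hsub

/-- The end-points `P = D'.boundary θ₁`, `Q = D'.boundary θ₂` of a free arc are distinct points of `∂D`, off
`D`. [folklore] -/
theorem free_endpoints :
    D'.boundary (sInf (connectedComponentIn F x)) ∈ frontier D.carrier ∧
      D'.boundary (sSup (connectedComponentIn F x)) ∈ frontier D.carrier ∧
      D'.boundary (sInf (connectedComponentIn F x)) ∉ D.carrier ∧
      D'.boundary (sSup (connectedComponentIn F x)) ∉ D.carrier ∧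
      D'.boundary (sInf (connectedComponentIn F x)) ≠ D'.boundary (sSup (connectedComponentIn F x)) := by
  obtain ⟨-, hi, hs, -, -, hix, hxs, hlen⟩ := free_component hF h0 h1 hx hxw
  have hiD : D'.boundary (sInf (connectedComponentIn F x)) ∉ D.carrier := (mem_free_iff hF _).not.1 hi
  have hsD : D'.boundary (sSup (connectedComponentIn F x)) ∉ D.carrier := (mem_free_iff hF _).not.1 hs
  have hcl : ∀ θ, D'.boundary θ ∈ closure D.carrier := fun θ ↦
    closure_mono hsub (frontier_subset_closure (D'.boundary_mem_frontier θ))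
  have hfr : ∀ θ, D'.boundary θ ∉ D.carrier → D'.boundary θ ∈ frontier D.carrier := fun θ hθ ↦ by
    rw [frontier, D.isOpen.interior_eq]
    exact ⟨hcl θ, hθ⟩
  refine ⟨hfr _ hiD, hfr _ hsD, hiD, hsD, fun h ↦ ?_⟩
  have := D'.injOn_boundary_Ico (sInf (connectedComponentIn F x)) ⟨le_rfl, by linarith⟩
    ⟨hix.le.trans hxs.le, by linarith⟩ h
  linarith

/-- **The closed free arc is a cross-cut of `D`** from `P` to `Q`: a simple arc whose non-end points lie in `D`.
[folklore] -/
theorem free_isCrosscut :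
    D.IsCrosscut (D'.boundary '' Icc (sInf (connectedComponentIn F x)) (sSup (connectedComponentIn F x)))
      (D'.boundary (sInf (connectedComponentIn F x))) (D'.boundary (sSup (connectedComponentIn F x))) := by
  obtain ⟨heq, -, -, -, -, hix, hxs, hlen⟩ := free_component hF h0 h1 hx hxw
  obtain ⟨hPfr, hQfr, -, -, hPQ⟩ := free_endpoints hF hsub h0 h1 hx hxw
  refine ⟨D'.isSimpleArc_image_boundary (hix.trans hxs) (by linarith), hPfr, hQfr, hPQ, ?_⟩
  rintro z ⟨⟨θ, hθ, rfl⟩, hz⟩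
  have hθ' : θ ∈ Ioo (sInf (connectedComponentIn F x)) (sSup (connectedComponentIn F x)) := by
    refine ⟨lt_of_le_of_ne hθ.1 fun h ↦ hz (Or.inl (by rw [← h])), lt_of_le_of_ne hθ.2 fun h ↦ hz (Or.inr ?_)⟩
    rw [h]; rfl
  exact ((free_image_Ioo_subset hF h0 h1 hx hxw) ⟨θ, hθ', rfl⟩).1

end Free

/-- **Registered helper stub `stub_radoFree`** (towards `stub_radoSqueezeFamily`, line `birth`): components of an
open subset of the line between two non-members are open intervals with non-member end-points. [folklore] -/
theorem stub_radoFree :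
    ∀ (F : Set ℝ), IsOpen F → ∀ (x l r : ℝ), x ∈ F → l ∉ F → r ∉ F → l < x → x < r →
      connectedComponentIn F x = Set.Ioo (sInf (connectedComponentIn F x)) (sSup (connectedComponentIn F x)) ∧
        sInf (connectedComponentIn F x) ∉ F ∧ sSup (connectedComponentIn F x) ∉ F :=
  fun _ hF _ _ _ hx hl hr hlx hxr ↦
    let h := component_eq_Ioo hF hx hl hr hlx hxr
    ⟨h.1, h.2.1, h.2.2.1⟩

end Summit.CriticalPhenomena.SAWScalingLimit.Theorems.RestrictionOfLimit.Birth

end
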